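import Summits.BirchSwinnertonDyer.BirchSwinnertonDyer.Theorems.SylvesterTwoHeegnerIndexCoupledDescentCebotarevLine
import Summits.BirchSwinnertonDyer.BirchSwinnertonDyer.Theorems.SylvesterTwoHeegnerIndexCoupledDescentF4Line
import Summits.BirchSwinnertonDyer.BirchSwinnertonDyer.Theorems.SylvesterTwoHeegnerIndexCoupledDescentF4Galois
import Literature.NumberTheory.EllipticCurves.SelmerTorsionCMOperatorJZero
import Literature.NumberTheory.EllipticCurves.HeegnerPointsKolyvaginPairingMap
import HarnessLib

/-!
# Leaf (L3) of the coupled Kolyvagin descent — instantiation data for `j = 0` curves at `p = 2`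

Helper toward crux `UpperOffV0HSYPlus` (stmt-BirchSwinnertonDyer-19804), skeleton VARIANT K, rows
k-p1/k-p2 (planner bsd-cm-plan D412 (2)). The generic Čebotarev clauses
`infinite_kolyvaginPrimes_ne` / `infinite_kolyvaginPrimes_line` (files `…CoupledDescentCebotarev`,
`…CoupledDescentCebotarevLine`) display, per curve `X`, twelve module-theoretic data on `X_K[p]`
and `H¹(K, X_K[p])`. This file DISCHARGES them at `p = 2` for a curve `X/ℚ` with
`a₁ = a₂ = a₃ = a₄ = 0` (the short models `C • E_p`, `C′ • E_{3p²}` of the stub's binders `A`, `B`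
with `C • B = cubeSumCurve p`, `C′ • A = cubeSumCurve (3p²)`) over an imaginary quadratic `K`
containing a primitive cube root of unity `ζ` (so `K = ℚ(ω)`; `K : Type`, the universe of the
tree's `JZero` package and of F4Galois's semilinearity lemma) with conjugation `c`, `c ζ = ζ²`:

* `hsy_curve_package` — from the `[ζ]`-isogeny data the rows build anyway
  (`JZero.exists_cm_isogeny_of_eq`: `φ` with `φ (x, y) = (ζ² x, y)` and `φ² + φ + 1 = 0`, its
  `X[2]`-restriction `fn` with `hcoe`) and the ONE arithmetic sentence «`t³ + a₆ ≠ 0` for all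
  `t ∈ K`» (`∛a₆ ∉ K`): the data `hS`, `w = fn` with `w³ = 1`, `hC`, `hcomm`, `ι = fn` inverting
  `z - 1` for some `z` (F4Galois `exists_absGal_smul_eq_of_no_cubeRoot` + F4Line), `hιg`,
  `wH = H¹(fn)` with `wH² + wH + 1 = 0` (`resH1Hom_id_apply_apply_add`) and
  `[wH x, ρ] = fn [x, ρ]` (`forall_h1Eval_resH1Hom_id`), the semilinearity
  `τ (fn P) = fn (fn (τ P))` for every lift `τ` of `c` (F4Galois `IsLiftOfAut.pointsMap_apply_cm`
  restricted to `X[2]`), hence `σ_* (wH x) = wH (wH (σ_* x))`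
  (`IsLiftOfAut.conjH1_resH1Hom_id`), the exponent `(E) = 3` (`F4Line.pow_three_smul`,
  `3 • P = P`), and a point `e′` with `(τe′ + e′, fn (τe′ + e′))` `2`-independent (`F4Line.exists_e0`).
* `hsy_exists_moving` — input (Z) of `exists_h1Eval_eq_pair_of_comm` (some `z ∈ Γ_K` fixing
  `B_K[2]` with `z - 1` onto `A_K[2]`) from the Kummer independence «`X³ + a₆(A)` has no root in
  `K(θ)` for every root `θ` of `X³ + a₆(B)`» (F4Galois `exists_absGal_fix_and_smul_eq`).

The two clauses (hL3a)/(hL3b) for the pair, with only these arithmetic sentences displayed, are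
the sibling `…CebotarevHSYClauses`. Nothing is asserted about 19804; no
definition, no named fact, no `sorry`; BSD is not claimed.
-/

-- every Summits module is named `Summit.<Summit>.<Problem>…`: the duplicated component is by design
set_option linter.dupNamespace false

noncomputable section

open scoped Classical
open WeierstrassCurve NumberField IsDedekindDomain Field
open Literature.NumberTheory.EllipticCurves Literature.NumberTheory.GaloisRepresentations

namespace Summit.BirchSwinnertonDyer.BirchSwinnertonDyer.Theorems.SylvesterTwoCoupledDescentCebotarev

variable {K : Type} [Field K] [NumberField K]

/-! ## The semilinearity of `[ζ]` under a lift of `c`, on `X_K[n]` -/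

section Semilinear

variable (X : WeierstrassCurve ℚ)

/-- **`τ ∘ [ζ] = [ζ]² ∘ τ` on `X_K[n]`** for any lift `τ` of `c ∈ Aut(K/ℚ)` with `c ζ = ζ²`, any
additive `φ` on `X_K(K̄)` acting by `(x, y) ↦ (ζ² x, y)` (F4Galois `IsLiftOfAut.pointsMap_apply_cm`,
the point-level statement) and its restriction `fn` to `X_K[n]` (`hcoe`): `τ (fn P) = fn (fn (τ P))`
— the hypothesis `hτw` of the `…CoupledDescentCebotarev` files and `hsemi` of
`IsLiftOfAut.conjH1_resH1Hom_id`. [cite: GrossLMS1991, §5 (5.1)] -/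
theorem torsionMap_apply_eq_apply_apply {ζ : K} {c : K ≃ₐ[ℚ] K} (hcζ : c ζ = ζ ^ 2) {τ : AlgebraicClosure K ≃+* AlgebraicClosure K} (hτ : IsLiftOfAut c τ)
    (φ : geomPoints (X.baseChange K) →+ geomPoints (X.baseChange K))
    (hφ : ∀ (x y : AlgebraicClosure K)
      (h : ((X.baseChange K).baseChange (AlgebraicClosure K)).toAffine.Nonsingular x y),
      ∃ h', φ (Affine.Point.some x y h) =
        Affine.Point.some (algebraMap K (AlgebraicClosure K) ζ ^ 2 * x) y h')
    {n : ℤ} (fn : geomTorsion (X.baseChange K) n →+ geomTorsion (X.baseChange K) n)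
    (hcoe : ∀ P : geomTorsion (X.baseChange K) n,
      ((fn P : geomTorsion (X.baseChange K) n) : geomPoints (X.baseChange K)) = φ P)
    (P : geomTorsion (X.baseChange K) n) :
    hτ.torsionMap X n (fn P) = fn (fn (hτ.torsionMap X n P)) := by
  apply Subtype.ext
  rw [IsLiftOfAut.coe_torsionMap, hcoe, hcoe, hcoe, IsLiftOfAut.coe_torsionMap]
  exact SylvesterTwoCoupledDescentF4Galois.IsLiftOfAut.pointsMap_apply_cm X hτ hcζ φ hφ P

end Semilinear

/-! ## The per-curve package at `p = 2` -/

section Package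

variable (X : WeierstrassCurve ℚ) [X.IsElliptic]

/-- **The twelve displayed data of the (L3) clauses, for one `j = 0` curve at `p = 2`.** `X/ℚ`
with `a₁ = a₂ = a₃ = a₄ = 0`, `K` a number field with a primitive cube root of unity `ζ`,
`c ∈ Aut(K/ℚ)` with `c ζ = ζ²` and an involutive lift `τ`, `φ = [ζ]` on `X_K(K̄)` with its
`X[2]`-restriction `fn`, and «`t³ + a₆ ≠ 0` on `K`». Then, with `T = X_K[2]`, `w = fn`,
`wH = H¹(fn)`: `T` is simple with commutant `{a + b w}`, `Γ_K` acts through commuting operators,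
some `z ∈ Γ_K` has `w (z • P - P) = P`, `w³ = 1`, `w (g • P) = g • w P`, `wH² + wH + 1 = 0`,
`[wH x, ρ] = w [x, ρ]`, `σ_* (wH x) = wH (wH (σ_* x))`, `τ (w P) = w (w (τ P))`, every `ρ³` fixes
`T`, `3 • P = P` on `T`, and some `e′` has `(τe′ + e′, w(τe′ + e′))` `2`-independent. Sources:
F4Line (`act_cases`, `simple`, `commutant`, `smul_comm`, `inv_sub`, `inv_smul`, `pow_three_smul`,
`exists_e0`), F4Galois (`exists_absGal_smul_eq_of_no_cubeRoot`), `card_torsionPoints_eq_sq_holds`,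
`resH1Hom_id_apply_apply_add`, `forall_h1Eval_resH1Hom_id`, `IsLiftOfAut.conjH1_resH1Hom_id`.
[cite: GrossLMS1991, §9 (Props. 9.1, 9.3)] -/
theorem hsy_curve_package (h1 : X.a₁ = 0) (h2 : X.a₂ = 0) (h3 : X.a₃ = 0) (h4 : X.a₄ = 0)
    {ζ : K} (hζ : IsPrimitiveRoot ζ 3) {c : K ≃ₐ[ℚ] K} (hcζ : c ζ = ζ ^ 2)
    {τ : AlgebraicClosure K ≃+* AlgebraicClosure K} (hτ : IsLiftOfAut c τ)
    (hinv : ∀ x, τ (τ x) = x)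
    (hX : ∀ t : K, t ^ 3 + algebraMap ℚ K X.a₆ ≠ 0)
    (φ : geomPoints (X.baseChange K) →+ geomPoints (X.baseChange K))
    (hφrel : ∀ P, φ (φ P) + φ P + P = 0)
    (hφ : ∀ (x y : AlgebraicClosure K)
      (h : ((X.baseChange K).baseChange (AlgebraicClosure K)).toAffine.Nonsingular x y),
      ∃ h', φ (Affine.Point.some x y h) =
        Affine.Point.some (algebraMap K (AlgebraicClosure K) ζ ^ 2 * x) y h')
    (fn : geomTorsion (X.baseChange K) ((2 : ℕ) : ℤ) →+ geomTorsion (X.baseChange K) ((2 : ℕ) : ℤ))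
    (hfn : ∀ (σ : absoluteGaloisGroup K) (P : geomTorsion (X.baseChange K) ((2 : ℕ) : ℤ)),
      fn (ContinuousMonoidHom.id _ σ • P) = σ • fn P)
    (hcoe : ∀ P : geomTorsion (X.baseChange K) ((2 : ℕ) : ℤ),
      ((fn P : geomTorsion (X.baseChange K) ((2 : ℕ) : ℤ)) : geomPoints (X.baseChange K)) = φ P) :
    (∀ H : AddSubgroup (geomTorsion (X.baseChange K) ((2 : ℕ) : ℤ)),
        (∀ g : absoluteGaloisGroup K, ∀ t ∈ H, g • t ∈ H) → H = ⊥ ∨ H = ⊤) ∧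
      (∀ P, fn (fn (fn P)) = P) ∧
      (∀ f : geomTorsion (X.baseChange K) ((2 : ℕ) : ℤ) →+ geomTorsion (X.baseChange K) ((2 : ℕ) : ℤ),
        (∀ (g : absoluteGaloisGroup K) (t : geomTorsion (X.baseChange K) ((2 : ℕ) : ℤ)),
          f (g • t) = g • f t) → ∃ a b : ℤ, ∀ t, f t = a • t + b • fn t) ∧
      (∀ (g h : absoluteGaloisGroup K) (P : geomTorsion (X.baseChange K) ((2 : ℕ) : ℤ)),
        g • h • P = h • g • P) ∧
      (∃ z : absoluteGaloisGroup K, ∀ P, fn (z • P - P) = P) ∧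
      (∀ (g : absoluteGaloisGroup K) (P : geomTorsion (X.baseChange K) ((2 : ℕ) : ℤ)),
        fn (g • P) = g • fn P) ∧
      (∀ x, resH1Hom (ContinuousMonoidHom.id _) fn hfn (resH1Hom (ContinuousMonoidHom.id _) fn hfn x) +
        resH1Hom (ContinuousMonoidHom.id _) fn hfn x + x = 0) ∧
      (∀ x, ∀ ρ ∈ torsionFixing (X.baseChange K) ((2 : ℕ) : ℤ),
        h1Eval (X.baseChange K) ((2 : ℕ) : ℤ) (resH1Hom (ContinuousMonoidHom.id _) fn hfn x) ρ =
          fn (h1Eval (X.baseChange K) ((2 : ℕ) : ℤ) x ρ)) ∧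
      (∀ x, conjAct X c ((2 : ℕ) : ℤ) (resH1Hom (ContinuousMonoidHom.id _) fn hfn x) =
        resH1Hom (ContinuousMonoidHom.id _) fn hfn
          (resH1Hom (ContinuousMonoidHom.id _) fn hfn (conjAct X c ((2 : ℕ) : ℤ) x))) ∧
      (∀ P, hτ.torsionMap X ((2 : ℕ) : ℤ) (fn P) = fn (fn (hτ.torsionMap X ((2 : ℕ) : ℤ) P))) ∧
      (∀ ρ : absoluteGaloisGroup K, ρ ^ 3 ∈ torsionFixing (X.baseChange K) ((2 : ℕ) : ℤ)) ∧
      (∀ P : geomTorsion (X.baseChange K) ((2 : ℕ) : ℤ), 3 • P = P) ∧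
      (∃ e' : geomTorsion (X.baseChange K) ((2 : ℕ) : ℤ), ∀ a b : ℤ,
        a • (hτ.torsionMap X ((2 : ℕ) : ℤ) e' + e') +
            b • fn (hτ.torsionMap X ((2 : ℕ) : ℤ) e' + e') = 0 →
          (((2 : ℕ) : ℤ)) ∣ a ∧ (((2 : ℕ) : ℤ)) ∣ b) := by
  -- `T = X_K[2]`: `P + P = 0`, `#T = 4`, a non-zero point
  have hT2 : ∀ P : geomTorsion (X.baseChange K) ((2 : ℕ) : ℤ), P + P = 0 := fun P ↦ by
    apply Subtype.ext
    have hP := (mem_geomTorsion_iff (X.baseChange K) ((2 : ℕ) : ℤ) (P : geomPoints _)).mp P.2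
    have hP' : (P : geomPoints (X.baseChange K)) + P = 0 := by
      rw [← two_zsmul]
      exact_mod_cast hP
    rw [AddMemClass.coe_add, ZeroMemClass.coe_zero]
    exact hP'
  have hcard : Nat.card (geomTorsion (X.baseChange K) ((2 : ℕ) : ℤ)) = 4 := by
    have h : Nat.card (geomTorsion (X.baseChange K) ((2 : ℕ) : ℤ)) = 2 ^ 2 :=
      card_torsionPoints_eq_sq_holds (X.baseChange K) (AlgebraicClosure K) (n := 2) (by norm_num)
    rw [h]
    norm_num
  have hTne : ∃ P : geomTorsion (X.baseChange K) ((2 : ℕ) : ℤ), P ≠ 0 := by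
    haveI : Finite (geomTorsion (X.baseChange K) ((2 : ℕ) : ℤ)) :=
      Nat.finite_of_card_ne_zero (by rw [hcard]; norm_num)
    haveI : Nontrivial (geomTorsion (X.baseChange K) ((2 : ℕ) : ℤ)) :=
      Finite.one_lt_card_iff_nontrivial.mp (by rw [hcard]; norm_num)
    exact exists_ne 0
  -- `fn² + fn + 1 = 0` and `fn` commutes with `Γ_K`
  have hrel : ∀ P : geomTorsion (X.baseChange K) ((2 : ℕ) : ℤ), fn (fn P) + fn P + P = 0 := by
    intro P
    apply Subtype.ext
    simp only [AddMemClass.coe_add, ZeroMemClass.coe_zero, hcoe]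
    exact hφrel P
  have hfn' : ∀ (g : absoluteGaloisGroup K) (P : geomTorsion (X.baseChange K) ((2 : ℕ) : ℤ)),
      fn (g • P) = g • fn P := fun g P ↦ hfn g P
  have hgf : ∀ (g : absoluteGaloisGroup K) (P : geomTorsion (X.baseChange K) ((2 : ℕ) : ℤ)),
      g • fn P = fn (g • P) := fun g P ↦ (hfn' g P).symm
  have hact := SylvesterTwoCoupledDescentF4Line.F4Line.act_cases hT2 hrel hcard hTne hgf
  -- some `z ∈ Γ_K` acts as `fn` (`∛a₆ ∉ K`)
  have hb : ∀ t : K, t ^ 3 + (X.baseChange K).a₆ ≠ 0 := by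
    intro t; simpa [WeierstrassCurve.baseChange] using hX t
  obtain ⟨z, hz⟩ := SylvesterTwoCoupledDescentF4Galois.exists_absGal_smul_eq_of_no_cubeRoot
    (X.baseChange K) (by simp [WeierstrassCurve.baseChange, h1])
    (by simp [WeierstrassCurve.baseChange, h2]) (by simp [WeierstrassCurve.baseChange, h3])
    (by simp [WeierstrassCurve.baseChange, h4]) hb hζ φ hφ
  have hz' : ∀ P : geomTorsion (X.baseChange K) ((2 : ℕ) : ℤ), z • P = fn P := by
    intro P
    apply Subtype.ext
    rw [Literature.NumberTheory.EllipticCurves.AddSubgroup.torsionBy.coe_smul, hcoe]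
    refine hz _ ?_
    have hP := (mem_geomTorsion_iff (X.baseChange K) ((2 : ℕ) : ℤ) (P : geomPoints _)).mp P.2
    rwa [natCast_zsmul] at hP
  -- the semilinearity and the involution `τ` on `T`
  have hτw : ∀ P, hτ.torsionMap X ((2 : ℕ) : ℤ) (fn P) = fn (fn (hτ.torsionMap X ((2 : ℕ) : ℤ) P)) :=
    torsionMap_apply_eq_apply_apply X hcζ hτ φ hφ fn hcoe
  have hττ : ∀ P, hτ.torsionMap X ((2 : ℕ) : ℤ) (hτ.torsionMap X ((2 : ℕ) : ℤ) P) = P :=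
    hτ.torsionMap_torsionMap X hinv _
  obtain ⟨e', -, -, he'⟩ := SylvesterTwoCoupledDescentF4Line.F4Line.exists_e0 hT2 hrel hcard hTne
    (hτ.torsionMap X ((2 : ℕ) : ℤ)) hττ hτw
  refine ⟨fun H hH ↦ SylvesterTwoCoupledDescentF4Line.F4Line.simple hT2 hrel hcard hz' H hH,
    SylvesterTwoCoupledDescentF4Line.F4Line.f_f_f hrel,
    fun f hf ↦ SylvesterTwoCoupledDescentF4Line.F4Line.commutant hT2 hrel hcard hTne hz' f hf,
    SylvesterTwoCoupledDescentF4Line.F4Line.smul_comm hact,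
    ⟨z, fun P ↦ by rw [hz']; exact SylvesterTwoCoupledDescentF4Line.F4Line.inv_sub hT2 hrel P⟩,
    hfn',
    resH1Hom_id_apply_apply_add _ fn hfn hrel,
    forall_h1Eval_resH1Hom_id _ _ fn hfn,
    fun x ↦ ?_, hτw,
    fun ρ ↦ (mem_torsionFixing_iff _ _).mpr fun P ↦
      SylvesterTwoCoupledDescentF4Line.F4Line.pow_three_smul hrel hact ρ P,
    fun P ↦ ?_, ⟨e', fun a b hab ↦ ?_⟩⟩
  · -- `σ_* (wH x) = wH (wH (σ_* x))`
    have h := hτ.conjH1_resH1Hom_id X (((2 : ℕ) : ℤ)) fn hfn hτw x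
    rwa [hτ.conjH1_eq_conjAct X (((2 : ℕ) : ℤ))] at h
  · -- `3 • P = P`
    rw [show (3 : ℕ) = 2 + 1 from rfl, add_nsmul, two_nsmul, one_nsmul, hT2 P, zero_add]
  · exact he' a b hab

end Package

/-! ## Input (Z): an element fixing `B_K[2]` and moving `A_K[2]` (`K(A[2]) ≠ K(B[2])`) -/

section Moving

variable (A B : WeierstrassCurve ℚ)

/-- **(Z) from Kummer independence.** For `j = 0` curves `A`, `B` over `ℚ` (short models) and
`K ∋ ζ`: if `X³ + a₆(A)` has no root in `K(θ)` for every root `θ ∈ K̄` of `X³ + a₆(B)`, then some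
`z ∈ Γ_K` fixes `B_K[2]` pointwise and has `z - 1` onto `A_K[2]` (it acts there as `[ζ]`, F4Galois
`exists_absGal_fix_and_smul_eq`; `[ζ]P - P ↦` everything since `[ζ]([ζ]Q) - [ζ]Q = Q` on `A[2]`).
This is the hypothesis `hzA`/`hzAsurj` of `exists_h1Eval_eq_pair_of_comm`. [folklore] -/
theorem hsy_exists_moving (hA1 : A.a₁ = 0) (hA2 : A.a₂ = 0) (hA3 : A.a₃ = 0) (hA4 : A.a₄ = 0)
    (hB1 : B.a₁ = 0) (hB2 : B.a₂ = 0) (hB3 : B.a₃ = 0) (hB4 : B.a₄ = 0)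
    {ζ : K} (hζ : IsPrimitiveRoot ζ 3)
    (hZ : ∀ θ : AlgebraicClosure K, θ ^ 3 + algebraMap ℚ (AlgebraicClosure K) B.a₆ = 0 →
      ∀ t : AlgebraicClosure K, t ∈ IntermediateField.adjoin K {θ} →
        t ^ 3 + algebraMap ℚ (AlgebraicClosure K) A.a₆ ≠ 0)
    (φ : geomPoints (A.baseChange K) →+ geomPoints (A.baseChange K))
    (hφrel : ∀ P, φ (φ P) + φ P + P = 0)
    (hφ : ∀ (x y : AlgebraicClosure K)
      (h : ((A.baseChange K).baseChange (AlgebraicClosure K)).toAffine.Nonsingular x y),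
      ∃ h', φ (Affine.Point.some x y h) =
        Affine.Point.some (algebraMap K (AlgebraicClosure K) ζ ^ 2 * x) y h')
    (fn : geomTorsion (A.baseChange K) ((2 : ℕ) : ℤ) →+ geomTorsion (A.baseChange K) ((2 : ℕ) : ℤ))
    (hcoe : ∀ P : geomTorsion (A.baseChange K) ((2 : ℕ) : ℤ),
      ((fn P : geomTorsion (A.baseChange K) ((2 : ℕ) : ℤ)) : geomPoints (A.baseChange K)) = φ P) :
    ∃ z : absoluteGaloisGroup K, z ∈ torsionFixing (B.baseChange K) ((2 : ℕ) : ℤ) ∧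
      ∀ Q : geomTorsion (A.baseChange K) ((2 : ℕ) : ℤ), ∃ P, z • P - P = Q := by
  have e6 : ∀ X : WeierstrassCurve ℚ, algebraMap K (AlgebraicClosure K) (X.baseChange K).a₆ =
      algebraMap ℚ (AlgebraicClosure K) X.a₆ := fun X ↦ by
    simp [WeierstrassCurve.baseChange]
  -- a root `θ` of `X³ + a₆(B)`
  obtain ⟨θ, hθ⟩ := IsAlgClosed.exists_pow_nat_eq (-(algebraMap ℚ (AlgebraicClosure K) B.a₆))
    (by norm_num : 0 < 3)
  have hθ' : θ ^ 3 + algebraMap K (AlgebraicClosure K) (B.baseChange K).a₆ = 0 := by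
    rw [e6, hθ, neg_add_cancel]
  have hZ' : ∀ t : AlgebraicClosure K, t ∈ IntermediateField.adjoin K {θ} →
      t ^ 3 + algebraMap K (AlgebraicClosure K) (A.baseChange K).a₆ ≠ 0 := by
    intro t ht; rw [e6]; exact hZ θ (by rw [← e6 B]; exact hθ') t ht
  obtain ⟨z, hzB, hzA⟩ := SylvesterTwoCoupledDescentF4Galois.exists_absGal_fix_and_smul_eq
    (A.baseChange K) (B.baseChange K)
    (by simp [WeierstrassCurve.baseChange, hA1]) (by simp [WeierstrassCurve.baseChange, hA2])
    (by simp [WeierstrassCurve.baseChange, hA3]) (by simp [WeierstrassCurve.baseChange, hA4])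
    (by simp [WeierstrassCurve.baseChange, hB1]) (by simp [WeierstrassCurve.baseChange, hB2])
    (by simp [WeierstrassCurve.baseChange, hB3]) (by simp [WeierstrassCurve.baseChange, hB4])
    hζ hθ' hZ' φ hφ
  have h2tor : ∀ (X : WeierstrassCurve ℚ) (P : geomTorsion (X.baseChange K) ((2 : ℕ) : ℤ)),
      (2 : ℕ) • (P : geomPoints (X.baseChange K)) = 0 := fun X P ↦ by
    have hP := (mem_geomTorsion_iff (X.baseChange K) ((2 : ℕ) : ℤ) (P : geomPoints _)).mp P.2
    rwa [natCast_zsmul] at hP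
  have hT2 : ∀ P : geomTorsion (A.baseChange K) ((2 : ℕ) : ℤ), P + P = 0 := fun P ↦ by
    apply Subtype.ext
    rw [AddMemClass.coe_add, ZeroMemClass.coe_zero, ← two_nsmul]
    exact h2tor A P
  have hrel : ∀ P : geomTorsion (A.baseChange K) ((2 : ℕ) : ℤ), fn (fn P) + fn P + P = 0 := by
    intro P
    apply Subtype.ext
    simp only [AddMemClass.coe_add, ZeroMemClass.coe_zero, hcoe]
    exact hφrel P
  have hz' : ∀ P : geomTorsion (A.baseChange K) ((2 : ℕ) : ℤ), z • P = fn P := fun P ↦ by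
    apply Subtype.ext
    rw [Literature.NumberTheory.EllipticCurves.AddSubgroup.torsionBy.coe_smul, hcoe]
    exact hzA _ (h2tor A P)
  refine ⟨z, (mem_torsionFixing_iff _ _).mpr fun P ↦ Subtype.ext ?_, fun Q ↦ ⟨fn Q, ?_⟩⟩
  · rw [Literature.NumberTheory.EllipticCurves.AddSubgroup.torsionBy.coe_smul]
    exact hzB _ (h2tor B P)
  · rw [hz']
    calc fn (fn Q) - fn Q = (fn (fn Q) + fn Q + Q) - (fn Q + fn Q) - Q := by abel
      _ = Q := by
        rw [hrel Q, hT2 (fn Q), sub_zero, zero_sub,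
          SylvesterTwoCoupledDescentF4Line.F4Line.neg_eq hT2]

end Moving

end Summit.BirchSwinnertonDyer.BirchSwinnertonDyer.Theorems.SylvesterTwoCoupledDescentCebotarev

end
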